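import Literature.NumberTheory.EllipticCurves.DeShalit1987.KatzMeasureMonomialLinesPAdic
import Mathlib.Algebra.Polynomial.Roots
import HarnessLib

set_option autoImplicit false

/-!
# A two-variable power series vanishing on infinitely many formal lines through the origin is zero
# (tangent-cone / leading-form argument): rigidity of `𝒪⟦T₁⟧⟦T₂⟧` from line restrictions

Topic `NumberTheory/EllipticCurves` (receptacle `𝒪_{ℂ_p}⟦T₁⟧⟦T₂⟧` of the two-variable Katz–de Shalit
frames; restrictions `IntSeries.curveSubst` / `IntSeries.monomialLine` of
`DeShalit1987/KatzMeasureMonomialLines(PAdic)`). For `H ∈ R⟦T₁⟧⟦T₂⟧` over a DOMAIN `R` and formal curves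
`(a₁(T), a₂(T))` through the origin with linear terms `(c₁, c₂)`, the lowest coefficient of the
restriction `H(a₁, a₂)` in degree `d = ord H` is the LEADING FORM of `H` evaluated at `(c₁, c₂)`
(`coeff_curveSubst_eq_leadingForm`); a non-zero binary form of degree `d` has at most `d` zeros up to
proportionality, so:

* `IntSeries.eq_zero_of_curveSubst_eq_zero` — if `H(a₁ˢ, a₂ˢ) = 0` for a family of curves through the
  origin whose linear terms `(c₁ˢ, c₂ˢ)` are pairwise non-proportional with `c₂ˢ ≠ 0` (`s ∈ ℕ`), then
  `H = 0`;
* `IntSeries.eq_zero_of_monomialLine_eq_zero` — in particular for the monomial lines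
  `H((1+T)^{c₁} − 1, (1+T)^{c₂} − 1)`, `(c₁, c₂) ∈ ℤ_p²`, of a two-variable frame (de Shalit's (52) as
  lines of (54)): a `G ∈ 𝒪_{ℂ_p}⟦T₁⟧⟦T₂⟧` with vanishing restriction to infinitely many pairwise
  non-proportional `ℤ_p`-lines is `0`; `IntSeries.eq_of_monomialLine_eq` — two series with the same
  restrictions to such a family of lines are EQUAL.

USE: uniqueness of the two-variable Katz–de Shalit measure in a frame `IsKatzMeasure₂` (the input of
the self-dual functional equation (SD) of crux `CycTangentCM.CycTangentBound`, stmt-BirchSwinnertonDyer-22628,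
skeleton `Cruxes/CycTangentBound/Lines/tangent_cone_parity.lean` stub `stub_selfDual`): two frames with
the same data restrict, along every `ℤ_p`-quotient through the pair carrying an admissible supply, to
one-variable branches (`IsKatzMeasure₂.isKatzBranch_monomialLine`, p584493) that coincide by the
one-variable rigidity at fixed periods (`IwasawaTwoVariable.isKatzBranch_ext_of_supply`); infinitely many
such directions exist (powers `Ψ₁^{−n}Ψ₂^{k}`, `k ≤ n`, of the everywhere-unramified type-`(w,0)` and
`(0,w)` characters, p585535 + p584708); this file is the step "⟹ the frames are equal". Pure algebra;
THEOREMS ONLY; nothing about any measure is asserted.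

References: E. de Shalit, *Iwasawa theory of elliptic curves with complex multiplication* (1987),
II.4.17 (51)–(54) (lines of the two-variable function); A. Cuoco, P. Monsky, Math. Ann. 255 (1981)
(leading forms and `ℤ_p`-lines of `ℤ_p²`-power series); [Washington1997] §13.
-/

noncomputable section

open scoped Classical
open Finset Polynomial

namespace Literature.NumberTheory.EllipticCurves.IntSeries

/-! ### §1. The leading form along a curve through the origin -/

section Formal

variable {R : Type*} [CommRing R]

/-- `[T^{i+j}](a₁^i a₂^j) = c₁^i c₂^j` for curves through the origin with linear terms `c₁, c₂`
(`aₖ = X·bₖ`, `bₖ(0) = cₖ`). [cite: deShalit1987, II.4.17 (51)–(54) (p. 77–78)] -/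
theorem coeff_add_pow_mul_pow {a₁ a₂ : PowerSeries R} (ha₁ : PowerSeries.constantCoeff a₁ = 0)
    (ha₂ : PowerSeries.constantCoeff a₂ = 0) (i j : ℕ) :
    PowerSeries.coeff (i + j) (a₁ ^ i * a₂ ^ j) =
      PowerSeries.coeff 1 a₁ ^ i * PowerSeries.coeff 1 a₂ ^ j := by
  -- `aₖ = X * bₖ`
  set b₁ : PowerSeries R := PowerSeries.mk fun n ↦ PowerSeries.coeff (n + 1) a₁ with hb₁
  set b₂ : PowerSeries R := PowerSeries.mk fun n ↦ PowerSeries.coeff (n + 1) a₂ with hb₂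
  have h₁ : a₁ = PowerSeries.X * b₁ := by
    have e := PowerSeries.eq_X_mul_shift_add_const a₁
    rwa [ha₁, map_zero, add_zero] at e
  have h₂ : a₂ = PowerSeries.X * b₂ := by
    have e := PowerSeries.eq_X_mul_shift_add_const a₂
    rwa [ha₂, map_zero, add_zero] at e
  have hc₁ : PowerSeries.constantCoeff b₁ = PowerSeries.coeff 1 a₁ := by
    rw [← PowerSeries.coeff_zero_eq_constantCoeff_apply, hb₁, PowerSeries.coeff_mk]
  have hc₂ : PowerSeries.constantCoeff b₂ = PowerSeries.coeff 1 a₂ := by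
    rw [← PowerSeries.coeff_zero_eq_constantCoeff_apply, hb₂, PowerSeries.coeff_mk]
  have hprod : a₁ ^ i * a₂ ^ j = PowerSeries.X ^ (i + j) * (b₁ ^ i * b₂ ^ j) := by
    rw [h₁, h₂, mul_pow, mul_pow, pow_add]; ring
  rw [hprod, PowerSeries.coeff_X_pow_mul', if_pos le_rfl, Nat.sub_self,
    PowerSeries.coeff_zero_eq_constantCoeff_apply, map_mul, map_pow, map_pow, hc₁, hc₂]

/-- **The degree-`d` coefficient of the restriction of a series of total order `≥ d` is its degree-`d`
form at the linear terms of the curve**: if `[T₁^iT₂^j]H = 0` for `i + j < d`, then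
`[T^d] H(a₁, a₂) = ∑_{i ≤ d} [T₁^iT₂^{d−i}]H · c₁^i c₂^{d−i}`.
[cite: deShalit1987, II.4.17 (51)–(54) (p. 77–78)] -/
theorem coeff_curveSubst_eq_leadingForm {a₁ a₂ : PowerSeries R}
    (ha₁ : PowerSeries.constantCoeff a₁ = 0) (ha₂ : PowerSeries.constantCoeff a₂ = 0)
    (H : PowerSeries (PowerSeries R)) {d : ℕ}
    (hord : ∀ i j : ℕ, i + j < d → PowerSeries.coeff j (PowerSeries.coeff i H) = 0) :
    PowerSeries.coeff d (curveSubst a₁ a₂ H) =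
      ∑ i ∈ range (d + 1), PowerSeries.coeff (d - i) (PowerSeries.coeff i H) *
        (PowerSeries.coeff 1 a₁ ^ i * PowerSeries.coeff 1 a₂ ^ (d - i)) := by
  rw [coeff_curveSubst]
  refine Finset.sum_congr rfl fun i hi ↦ ?_
  have hi' : i ≤ d := Nat.lt_succ_iff.mp (Finset.mem_range.mp hi)
  rw [Finset.sum_eq_single (d - i)]
  · have hij : i + (d - i) = d := by omega
    rw [← coeff_add_pow_mul_pow ha₁ ha₂ i (d - i), hij]
  · intro j hj hne
    rcases Nat.lt_or_gt_of_ne hne with hlt | hgt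
    · -- `i + j < d`: the coefficient of `H` vanishes
      rw [hord i j (by omega), zero_mul]
    · -- `i + j > d`: the curve term vanishes
      rw [coeff_pow_mul_pow_eq_zero_of_lt ha₁ ha₂ (by omega), mul_zero]
  · intro h
    exact absurd (Finset.mem_range.mpr (by omega)) h

end Formal

/-! ### §2. Infinitely many lines through the origin -/

section Domain

variable {R : Type*} [CommRing R] [IsDomain R]

/-- **A non-zero binary form over a domain has finitely many zeros up to proportionality**: if
`∑_{i ≤ d} h_i c₁ˢ^i c₂ˢ^{d−i} = 0` for all `s`, with `c₂ˢ ≠ 0` and the `(c₁ˢ, c₂ˢ)` pairwise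
non-proportional (`s ∈ ℕ`), then all `h_i = 0` (the polynomial `∑ h_i X^i` has the infinitely many
roots `c₁ˢ/c₂ˢ` in the fraction field). [cite: Washington1997, §13 (power series in two variables)] -/
theorem binaryForm_eq_zero_of_infinite_zeros {d : ℕ} (h : ℕ → R) (c₁ c₂ : ℕ → R)
    (hc₂ : ∀ s, c₂ s ≠ 0) (hprop : ∀ s t, s ≠ t → c₁ s * c₂ t ≠ c₁ t * c₂ s)
    (hzero : ∀ s, ∑ i ∈ range (d + 1), h i * (c₁ s ^ i * c₂ s ^ (d - i)) = 0) :
    ∀ i ≤ d, h i = 0 := by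
  -- work in the fraction field
  set F := FractionRing R with hF
  set ι : R →+* F := algebraMap R F with hι
  have hιinj : Function.Injective ι := IsFractionRing.injective R F
  set P : F[X] := ∑ i ∈ range (d + 1), Polynomial.C (ι (h i)) * Polynomial.X ^ i with hP
  -- every ratio `c₁ˢ/c₂ˢ` is a root of `P`
  have hroot : ∀ s, P.IsRoot (ι (c₁ s) / ι (c₂ s)) := by
    intro s
    have hc : ι (c₂ s) ≠ 0 := (map_ne_zero_iff ι hιinj).mpr (hc₂ s)
    have hcd : ι (c₂ s) ^ d ≠ 0 := pow_ne_zero _ hc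
    rw [Polynomial.IsRoot, hP, Polynomial.eval_finsetSum]
    simp only [Polynomial.eval_mul, Polynomial.eval_C, Polynomial.eval_pow, Polynomial.eval_X]
    have key : (∑ i ∈ range (d + 1), ι (h i) * (ι (c₁ s) / ι (c₂ s)) ^ i) * ι (c₂ s) ^ d = 0 := by
      rw [Finset.sum_mul]
      have := congrArg ι (hzero s)
      rw [map_sum, map_zero] at this
      rw [← this]
      refine Finset.sum_congr rfl fun i hi ↦ ?_
      have hi' : i ≤ d := Nat.lt_succ_iff.mp (Finset.mem_range.mp hi)
      have hterm : (ι (c₁ s) / ι (c₂ s)) ^ i * ι (c₂ s) ^ d = ι (c₁ s) ^ i * ι (c₂ s) ^ (d - i) := by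
        rw [div_pow, div_mul_eq_mul_div, div_eq_iff (pow_ne_zero _ hc), mul_assoc, ← pow_add,
          Nat.sub_add_cancel hi']
      rw [map_mul, map_mul, map_pow, map_pow, mul_assoc, hterm]
    exact (mul_eq_zero.mp key).resolve_right hcd
  -- infinitely many distinct roots
  have hinj : Function.Injective fun s : ℕ ↦ ι (c₁ s) / ι (c₂ s) := by
    intro s t hst
    by_contra hne
    have hcs : ι (c₂ s) ≠ 0 := (map_ne_zero_iff ι hιinj).mpr (hc₂ s)
    have hct : ι (c₂ t) ≠ 0 := (map_ne_zero_iff ι hιinj).mpr (hc₂ t)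
    have h' : ι (c₁ s) * ι (c₂ t) = ι (c₁ t) * ι (c₂ s) := by
      simp only at hst
      rw [div_eq_div_iff hcs hct] at hst
      linear_combination hst
    rw [← map_mul, ← map_mul] at h'
    exact hprop s t hne (hιinj h')
  have hinf : Set.Infinite {x : F | P.IsRoot x} :=
    Set.infinite_of_injective_forall_mem hinj hroot
  have hP0 : P = 0 := Polynomial.eq_zero_of_infinite_isRoot P hinf
  -- read off the coefficients
  intro i hi
  have hcoef : P.coeff i = ι (h i) := by
    rw [hP, Polynomial.finsetSum_coeff]
    simp only [Polynomial.coeff_C_mul, Polynomial.coeff_X_pow]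
    rw [Finset.sum_eq_single i]
    · rw [if_pos rfl, mul_one]
    · intro j _ hji
      rw [if_neg (Ne.symm hji), mul_zero]
    · intro hmem
      exact absurd (Finset.mem_range.mpr (Nat.lt_succ_of_le hi)) hmem
  rw [hP0, Polynomial.coeff_zero] at hcoef
  exact hιinj (by rw [map_zero]; exact hcoef.symm)

/-- **A two-variable series vanishing along infinitely many curves through the origin with pairwise
non-proportional tangents is zero.** `H ∈ R⟦T₁⟧⟦T₂⟧` over a domain; curves `(a₁ˢ, a₂ˢ)` through the
origin (`s ∈ ℕ`) with linear terms `(c₁ˢ, c₂ˢ)`, `c₂ˢ ≠ 0`, pairwise non-proportional; if every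
restriction `H(a₁ˢ, a₂ˢ)` vanishes then `H = 0` (otherwise the leading form of `H`, of degree
`d = ord H`, would have infinitely many zeros up to proportionality). [cite: Washington1997, §13]
[cite: deShalit1987, II.4.17 (51)–(54) (p. 77–78)] -/
theorem eq_zero_of_curveSubst_eq_zero (H : PowerSeries (PowerSeries R))
    (a₁ a₂ : ℕ → PowerSeries R) (ha₁ : ∀ s, PowerSeries.constantCoeff (a₁ s) = 0)
    (ha₂ : ∀ s, PowerSeries.constantCoeff (a₂ s) = 0) (hc₂ : ∀ s, PowerSeries.coeff 1 (a₂ s) ≠ 0)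
    (hprop : ∀ s t, s ≠ t → PowerSeries.coeff 1 (a₁ s) * PowerSeries.coeff 1 (a₂ t) ≠
      PowerSeries.coeff 1 (a₁ t) * PowerSeries.coeff 1 (a₂ s))
    (hzero : ∀ s, curveSubst (a₁ s) (a₂ s) H = 0) : H = 0 := by
  by_contra hH
  -- the total order `d` of `H`
  have hex : ∃ n : ℕ, ∃ i j : ℕ, i + j = n ∧ PowerSeries.coeff j (PowerSeries.coeff i H) ≠ 0 := by
    by_contra hnone
    push Not at hnone
    apply hH
    ext i j
    rw [map_zero, map_zero]
    exact hnone (i + j) i j rfl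
  set d := Nat.find hex with hd
  obtain ⟨i₀, j₀, hij₀, hne⟩ := Nat.find_spec hex
  have hord : ∀ i j : ℕ, i + j < d → PowerSeries.coeff j (PowerSeries.coeff i H) = 0 := by
    intro i j hij
    by_contra hne'
    exact Nat.find_min hex hij ⟨i, j, rfl, hne'⟩
  -- the leading form vanishes at every `(c₁ˢ, c₂ˢ)`
  have hform : ∀ s, ∑ i ∈ range (d + 1), PowerSeries.coeff (d - i) (PowerSeries.coeff i H) *
      (PowerSeries.coeff 1 (a₁ s) ^ i * PowerSeries.coeff 1 (a₂ s) ^ (d - i)) = 0 := by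
    intro s
    rw [← coeff_curveSubst_eq_leadingForm (ha₁ s) (ha₂ s) H hord, hzero s, map_zero]
  have hall := binaryForm_eq_zero_of_infinite_zeros
    (fun i ↦ PowerSeries.coeff (d - i) (PowerSeries.coeff i H)) (fun s ↦ PowerSeries.coeff 1 (a₁ s))
    (fun s ↦ PowerSeries.coeff 1 (a₂ s)) hc₂ hprop hform
  have hi₀ : i₀ ≤ d := by rw [hd]; omega
  have := hall i₀ hi₀
  rw [show d - i₀ = j₀ by rw [hd]; omega] at this
  exact hne this

end Domain

/-! ### §3. Monomial lines of `𝒪_{ℂ_p}⟦T₁⟧⟦T₂⟧` -/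

section Padic

variable {p : ℕ} [Fact p.Prime]

/-- The linear term of `(1+T)^c − 1` is `c`. [cite: Koblitz1984, Ch. IV §1] -/
theorem coeff_one_binomPow_sub_one (c : ℤ_[p]) :
    PowerSeries.coeff 1 (binomPow c - 1) = padicIntToComplexInt p c := by
  rw [map_sub, coeff_binomPow, Ring.choose_one_right, PowerSeries.coeff_one, if_neg one_ne_zero,
    sub_zero]

/-- `ℤ_p → 𝒪_{ℂ_p}` is injective. [cite: Koblitz1984, Ch. III §3–§4] -/
theorem padicIntToComplexInt_injective : Function.Injective (padicIntToComplexInt p) := by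
  intro x y h
  have h' := congrArg (fun z : PadicComplexInt p ↦ (z : ℂ_[p])) h
  simp only [coe_padicIntToComplexInt] at h'
  have h'' : ((x : ℚ_[p])) = (y : ℚ_[p]) := by
    have := (algebraMap ℚ_[p] ℂ_[p]).injective
    exact this h'
  exact Subtype.ext h''

/-- **A series of `𝒪_{ℂ_p}⟦T₁⟧⟦T₂⟧` vanishing along infinitely many pairwise non-proportional
`ℤ_p`-lines through the origin is zero**: if `G((1+T)^{c₁ˢ} − 1, (1+T)^{c₂ˢ} − 1) = 0` for all `s`
with `c₂ˢ ≠ 0` and `c₁ˢc₂ᵗ ≠ c₁ᵗc₂ˢ` (`s ≠ t`), then `G = 0`.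
[cite: deShalit1987, II.4.17 (51)–(54) (p. 77–78)] [cite: Washington1997, §13] -/
theorem eq_zero_of_monomialLine_eq_zero (G : PowerSeries (PowerSeries (PadicComplexInt p)))
    (c₁ c₂ : ℕ → ℤ_[p]) (hc₂ : ∀ s, c₂ s ≠ 0) (hprop : ∀ s t, s ≠ t → c₁ s * c₂ t ≠ c₁ t * c₂ s)
    (hzero : ∀ s, monomialLine (c₁ s) (c₂ s) G = 0) : G = 0 := by
  refine eq_zero_of_curveSubst_eq_zero G (fun s ↦ binomPow (c₁ s) - 1) (fun s ↦ binomPow (c₂ s) - 1)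
    (fun s ↦ constantCoeff_binomPow_sub_one _) (fun s ↦ constantCoeff_binomPow_sub_one _)
    (fun s ↦ ?_) (fun s t hst ↦ ?_) hzero
  · rw [coeff_one_binomPow_sub_one]
    exact (map_ne_zero_iff _ padicIntToComplexInt_injective).mpr (hc₂ s)
  · simp only [coeff_one_binomPow_sub_one, ← map_mul]
    exact fun h ↦ hprop s t hst (padicIntToComplexInt_injective h)

/-- **Rigidity from line restrictions**: two series of `𝒪_{ℂ_p}⟦T₁⟧⟦T₂⟧` whose restrictions to
infinitely many pairwise non-proportional `ℤ_p`-lines through the origin agree are equal.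
[cite: deShalit1987, II.4.17 (51)–(54) (p. 77–78)] -/
theorem eq_of_monomialLine_eq (G G' : PowerSeries (PowerSeries (PadicComplexInt p)))
    (c₁ c₂ : ℕ → ℤ_[p]) (hc₂ : ∀ s, c₂ s ≠ 0) (hprop : ∀ s t, s ≠ t → c₁ s * c₂ t ≠ c₁ t * c₂ s)
    (heq : ∀ s, monomialLine (c₁ s) (c₂ s) G = monomialLine (c₁ s) (c₂ s) G') : G = G' := by
  have hlin : ∀ s, monomialLine (c₁ s) (c₂ s) (G - G') = 0 := fun s ↦ by
    have : monomialLine (c₁ s) (c₂ s) (G - G') =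
        monomialLine (c₁ s) (c₂ s) G - monomialLine (c₁ s) (c₂ s) G' := by
      ext n
      simp only [monomialLine, coeff_curveSubst, map_sub, sub_mul, Finset.sum_sub_distrib]
    rw [this, heq s, sub_self]
  exact sub_eq_zero.mp (eq_zero_of_monomialLine_eq_zero (G - G') c₁ c₂ hc₂ hprop hlin)

end Padic

end Literature.NumberTheory.EllipticCurves.IntSeries

end
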